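import Summits.AnomalousDissipation.AnomalousDissipation.Theorems.SawtoothPulseCascadeK1LocalisedCascadeSlotFibreExpansion

/-!
# K1loc, line `Spectral` / SeqCone — helper: THE UN-GAUGING STEP UNDER MAX-COMPATIBILITY (partition form)

Helper file of the prover lane on the crux `K1LocalisedCascade` (stmt-AnomalousDissipation-19491), route
`SawtoothPulseCascade` (memo v5 §4, the "weight doubling" design question, RESOLVED here).  The per-fibre two-strip
estimate of `…SlotFibreExpansion` bounds each branch `e_{−b^σ e_j} Θ^σ G` by the FULL fibre function `G`
(`‖Θ^σ‖ ≤ 1`), so summing the two strip families `σ = ±` needs the SUM-compatibility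
`m(k − b⁺e_j)² + m(k − b⁻e_j)² ≤ μ(k)²` of the new symbol `m` with the old symbol `μ`, which forces `μ ≥ √2·m` wherever
the two branch preimages overlap.  Here the branch is first DOMINATED by the old symbol
(`m(k − b^σ e_j)² ≤ μ(k)²` on the fibre — max-compatibility, each `σ` separately), then `μ(D)(Θ^σ G)` is expanded to
order `r` KEEPING the principal term as the `L²` norm of the product `Θ^σ · μ(D)G` (`sqrt_tsum_symbol_sq_mul_le_of_expansion_keep`,
the variant of `…SlotExpansion.sqrt_tsum_symbol_sq_mul_le_of_expansion` that does not estimate `‖Θ_0·m_0(D)F‖` by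
`B_0‖m_0(D)F‖`), and the two families are summed with the PARTITION inequality `|X⁺|² + |X⁻|² ≤ 1`
(`integral_norm_sq_mul_add_le`): `‖Θ⁺·h‖² + ‖Θ⁻·h‖² ≤ ‖h‖²`, `h = μ(D)G`.  Result (`tsum_symbol_sq_twoStrip_fibre_le_max`,
one fibre `k_i = n`):
  `Σ' m²|𝓕((X⁺+X⁻)(x_j)·(G∘Φ))|² ≤ (√Σ' μ²|𝓕G|² + √(A⁺²+A⁻²)‖G‖)² + 2C‖G‖²`,
`A^σ = Σ_{1≤α<r} B^σ_α M_α + L W^σ` (now with the derivative data of the OLD symbol `μ`), `C = L₂ W₂` (cross term, data of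
the squared shifted new symbol as before) — the shape of the abstract per-fibre hypothesis of `…SlotFibreSumMax`.
No definitions; no statement about the stub.
[cite: Grafakos2014, Prop. 3.1.2 (5) (coefficients of products, translations and modulations) and Prop. 3.2.7 (3)
(Parseval)] [problem: turb]
-/

-- `Summit.<Summit>.<Problem>`: single-conjunct summit, the duplicate namespace segment is deliberate.
set_option linter.dupNamespace false

noncomputable section

namespace Summit.AnomalousDissipation.AnomalousDissipation.Theorems.SawtoothPulseCascade.K1Slot

open MeasureTheory Set Filter Topology UnitAddTorus Complex
open scoped ComplexConjugate
open Literature.Analysis Literature.Analysis.FunctionSpaces Literature.Analysis.FluidPDE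
open Literature.Analysis.FunctionSpaces.Torus
open Summit.AnomalousDissipation.AnomalousDissipation.Theorems.SawtoothPulseCascade.SpectralLeakage

variable {d : Type*} [Fintype d]

/-! ## The expansion bound keeping the principal term -/

/-- **The higher-order bound for `‖m(D)(Θ·F)‖`, principal term kept.**  Under the expansion data of
`symbol_mul_product_expansion` (`0 < r`, `Θ_0 = Θ`, `m_0 = m`), sup bounds `‖Θ_α‖ ≤ B_α` and the discrete Taylor remainder
`‖m(k) − Σ_{α<r}(2πi q_j)^α m_α(k−q)‖ ≤ L ρ(q)` on the spectrum of `Θ`: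
`√(Σₖ m_k² ‖𝓕(ΘF)(k)‖²) ≤ √(∫‖Θ · m(D)F‖²) + Σ_{1≤α<r} B_α √(Σₖ ‖m_α(k)‖² ‖𝓕F(k)‖²) + L (Σ_q ρ(q)‖𝓕Θ(q)‖) √∫‖F‖²`,
`m(D)F` the Fourier synthesis of `m·𝓕F` — i.e. `‖m(D)(ΘF) − Θ·m(D)F‖ ≤ Σ_{1≤α<r} B_α‖m_α(D)F‖ + ‖R‖` in norm form.
(`…SlotExpansion.sqrt_tsum_symbol_sq_mul_le_of_expansion` is the same bound with the principal term estimated by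
`B_0‖m(D)F‖`.) [cite: Grafakos2014, Prop. 3.1.2 (5) and Prop. 3.2.7 (3)] -/
theorem sqrt_tsum_symbol_sq_mul_le_of_expansion_keep {F Θ : UnitAddTorus d → ℂ} (hF : Continuous F)
    (hFs : Summable fun k => ‖mFourierCoeff F k‖) (hΘ : Continuous Θ) (hΘs : Summable fun q => ‖mFourierCoeff Θ q‖)
    (j : d) {r : ℕ} (hr : 0 < r) {Θd : ℕ → UnitAddTorus d → ℂ} (hΘd_c : ∀ α ∈ Finset.range r, Continuous (Θd α))
    (hΘd_s : ∀ α ∈ Finset.range r, Summable fun q => ‖mFourierCoeff (Θd α) q‖)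
    (hΘd : ∀ α ∈ Finset.range r, ∀ q, mFourierCoeff (Θd α) q = (2 * Real.pi * I * (q j : ℂ)) ^ α * mFourierCoeff Θ q)
    (hΘd0 : Θd 0 = Θ) {B : ℕ → ℝ} (hB : ∀ α ∈ Finset.range r, ∀ x, ‖Θd α x‖ ≤ B α)
    {m : (d → ℤ) → ℝ} {md : ℕ → (d → ℤ) → ℂ} (hmd0 : ∀ k, md 0 k = (m k : ℂ)) {Md : ℝ}
    (hMd : ∀ α ∈ Finset.range r, ∀ k, ‖md α k‖ ≤ Md) {ρ : (d → ℤ) → ℝ} {L : ℝ} (hρ0 : ∀ q, 0 ≤ ρ q) (hL : 0 ≤ L)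
    (hT : ∀ k q, mFourierCoeff Θ q ≠ 0 →
      ‖(m k : ℂ) - ∑ α ∈ Finset.range r, (2 * Real.pi * I * (q j : ℂ)) ^ α * md α (k - q)‖ ≤ L * ρ q)
    (hρs : Summable fun q => ρ q * ‖mFourierCoeff Θ q‖) :
    Real.sqrt (∑' k, m k ^ 2 * ‖mFourierCoeff (fun x => Θ x * F x) k‖ ^ 2) ≤
      Real.sqrt (∫ x, ‖Θ x * fourierSynth (fun k => (m k : ℂ) * mFourierCoeff F k) x‖ ^ 2) +
        ∑ α ∈ Finset.Ico 1 r, B α * Real.sqrt (∑' k, ‖md α k‖ ^ 2 * ‖mFourierCoeff F k‖ ^ 2) +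
        L * (∑' q, ρ q * ‖mFourierCoeff Θ q‖) * Real.sqrt (∫ x, ‖F x‖ ^ 2) := by
  classical
  -- the remainder family and its bound
  obtain ⟨_, hRs, hR⟩ := sqrt_tsum_sq_kernel_le hF hFs (c := mFourierCoeff Θ)
    (fun k q => (m k : ℂ) - ∑ α ∈ Finset.range r, (2 * Real.pi * I * (q j : ℂ)) ^ α * md α (k - q)) hρ0 hL hT hρs
  set f : (d → ℤ) → ℂ := mFourierCoeff F with hf_def
  have hB0 : ∀ α ∈ Finset.range r, 0 ≤ B α := fun α hα => (norm_nonneg _).trans (hB α hα 0)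
  set R : (d → ℤ) → ℂ := fun k => ∑' q, mFourierCoeff Θ q *
    (((m k : ℂ) - ∑ α ∈ Finset.range r, (2 * Real.pi * I * (q j : ℂ)) ^ α * md α (k - q)) * f (k - q)) with hR_def
  -- the pieces `P_α = Θ_α · m_α(D)F` and their `L²` norms
  have hh : ∀ α ∈ Finset.range r, Summable fun k => ‖md α k * f k‖ := fun α hα =>
    (hFs.mul_left Md).of_nonneg_of_le (fun _ => norm_nonneg _) fun k => by
      rw [norm_mul]; exact mul_le_mul_of_nonneg_right (hMd α hα k) (norm_nonneg _)
  have hH_c : ∀ α ∈ Finset.range r, Continuous (fourierSynth fun k => md α k * f k) := fun α hα =>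
    continuous_fourierSynth (hh α hα)
  have hH_coeff : ∀ α ∈ Finset.range r, ∀ k, mFourierCoeff (fourierSynth fun k => md α k * f k) k = md α k * f k :=
    fun α hα => mFourierCoeff_fourierSynth (hh α hα)
  set Pc : ℕ → (d → ℤ) → ℂ := fun α k => mFourierCoeff (fun x => Θd α x * fourierSynth (fun k => md α k * f k) x) k
    with hPc_def
  have hP_c : ∀ α ∈ Finset.range r, Continuous (fun x => Θd α x * fourierSynth (fun k => md α k * f k) x) :=
    fun α hα => (hΘd_c α hα).mul (hH_c α hα)
  have hPars : ∀ α ∈ Finset.range r, HasSum (fun k => ‖Pc α k‖ ^ 2)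
      (∫ x, ‖Θd α x * fourierSynth (fun k => md α k * f k) x‖ ^ 2) := fun α hα =>
    hasSum_sq_mFourierCoeff_of_continuous (hP_c α hα)
  have hParsH : ∀ α ∈ Finset.range r, HasSum (fun k => ‖md α k * f k‖ ^ 2)
      (∫ x, ‖fourierSynth (fun k => md α k * f k) x‖ ^ 2) := fun α hα => by
    have h := hasSum_sq_mFourierCoeff_of_continuous (hH_c α hα)
    simp_rw [hH_coeff α hα] at h
    exact h
  -- `‖P_α‖ ≤ B_α ‖m_α(D)F‖`
  have hPle : ∀ α ∈ Finset.range r, Real.sqrt (∑' k, ‖Pc α k‖ ^ 2) ≤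
      B α * Real.sqrt (∑' k, ‖md α k‖ ^ 2 * ‖f k‖ ^ 2) := by
    intro α hα
    rw [(hPars α hα).tsum_eq]
    have h1 : ∫ x, ‖Θd α x * fourierSynth (fun k => md α k * f k) x‖ ^ 2 ≤
        B α ^ 2 * ∫ x, ‖fourierSynth (fun k => md α k * f k) x‖ ^ 2 :=
      integral_norm_sq_mul_le (hH_c α hα) (hB α hα)
    have h2 : ∫ x, ‖fourierSynth (fun k => md α k * f k) x‖ ^ 2 = ∑' k, ‖md α k‖ ^ 2 * ‖f k‖ ^ 2 := by
      rw [← (hParsH α hα).tsum_eq]; exact tsum_congr fun k => by rw [norm_mul, mul_pow]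
    calc Real.sqrt (∫ x, ‖Θd α x * fourierSynth (fun k => md α k * f k) x‖ ^ 2)
        ≤ Real.sqrt (B α ^ 2 * ∫ x, ‖fourierSynth (fun k => md α k * f k) x‖ ^ 2) := Real.sqrt_le_sqrt h1
      _ = B α * Real.sqrt (∑' k, ‖md α k‖ ^ 2 * ‖f k‖ ^ 2) := by
          rw [Real.sqrt_mul' _ (integral_nonneg fun x => by positivity), Real.sqrt_sq (hB0 α hα), h2]
  -- the principal piece `P_0 = Θ · m(D)F`, kept
  have h0mem : 0 ∈ Finset.range r := Finset.mem_range.mpr hr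
  have hP0 : Real.sqrt (∑' k, ‖Pc 0 k‖ ^ 2) =
      Real.sqrt (∫ x, ‖Θ x * fourierSynth (fun k => (m k : ℂ) * mFourierCoeff F k) x‖ ^ 2) := by
    rw [(hPars 0 h0mem).tsum_eq, hΘd0]
    have hmd0' : (fun k => md 0 k * f k) = fun k => (m k : ℂ) * mFourierCoeff F k := by
      funext k; rw [hmd0 k]
    rw [hmd0']
  -- the identity `m k 𝓕(ΘF) k = Σ_α P_α k + R k`
  have hid : ∀ k, (m k : ℂ) * mFourierCoeff (fun x => Θ x * F x) k = ∑ α ∈ Finset.range r, Pc α k + R k := by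
    intro k
    have h := symbol_mul_product_expansion hF hFs hΘ hΘs j r hΘd_c hΘd_s hΘd m hMd k
    rw [sub_eq_iff_eq_add'] at h
    rw [h]
  -- Minkowski in `ℓ²`
  have hsq : ∀ k, m k ^ 2 * ‖mFourierCoeff (fun x => Θ x * F x) k‖ ^ 2 =
      ‖(m k : ℂ) * mFourierCoeff (fun x => Θ x * F x) k‖ ^ 2 := fun k => by
    rw [norm_mul, Complex.norm_real, Real.norm_eq_abs, mul_pow, sq_abs]
  simp_rw [hsq, hid]
  have hPs : ∀ α ∈ Finset.range r, Summable fun k => ‖Pc α k‖ ^ 2 := fun α hα => (hPars α hα).summable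
  -- `√Σ‖Σ_α P_α + R‖² ≤ Σ_α √Σ‖P_α‖² + √Σ‖R‖²`
  have hMink : ∀ (s : Finset ℕ), (∀ α ∈ s, Summable fun k => ‖Pc α k‖ ^ 2) →
      (Summable fun k => ‖∑ α ∈ s, Pc α k + R k‖ ^ 2) ∧
      Real.sqrt (∑' k, ‖∑ α ∈ s, Pc α k + R k‖ ^ 2) ≤
        ∑ α ∈ s, Real.sqrt (∑' k, ‖Pc α k‖ ^ 2) + Real.sqrt (∑' k, ‖R k‖ ^ 2) := by
    intro s hs
    induction s using Finset.induction_on with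
    | empty => exact ⟨by simpa using hRs, by simp⟩
    | @insert a s ha ih =>
      obtain ⟨ih1, ih2⟩ := ih fun α hα => hs α (Finset.mem_insert_of_mem hα)
      have hPa := hs a (Finset.mem_insert_self a s)
      have hM := Real.Lp_add_le_tsum_of_nonneg (p := 2) (f := fun k => ‖Pc a k‖) (g := fun k => ‖∑ α ∈ s, Pc α k + R k‖)
        (by norm_num) (fun k => norm_nonneg _) (fun k => norm_nonneg _)
        (by simpa using hPa) (by simpa using ih1)
      simp only [Real.rpow_two] at hM
      obtain ⟨hM1, hM2⟩ := hM
      have hptle : ∀ k, ‖∑ α ∈ insert a s, Pc α k + R k‖ ^ 2 ≤ (‖Pc a k‖ + ‖∑ α ∈ s, Pc α k + R k‖) ^ 2 := fun k => by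
        rw [Finset.sum_insert ha, add_assoc]
        exact pow_le_pow_left₀ (norm_nonneg _) (norm_add_le _ _) 2
      have hS : Summable fun k => ‖∑ α ∈ insert a s, Pc α k + R k‖ ^ 2 :=
        hM1.of_nonneg_of_le (fun k => sq_nonneg _) hptle
      refine ⟨hS, ?_⟩
      rw [Finset.sum_insert ha]
      have h1 : Real.sqrt (∑' k, ‖∑ α ∈ insert a s, Pc α k + R k‖ ^ 2) ≤
          Real.sqrt (∑' k, (‖Pc a k‖ + ‖∑ α ∈ s, Pc α k + R k‖) ^ 2) :=
        Real.sqrt_le_sqrt (hS.tsum_le_tsum hptle hM1)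
      have h2 : Real.sqrt (∑' k, (‖Pc a k‖ + ‖∑ α ∈ s, Pc α k + R k‖) ^ 2) ≤
          Real.sqrt (∑' k, ‖Pc a k‖ ^ 2) + Real.sqrt (∑' k, ‖∑ α ∈ s, Pc α k + R k‖ ^ 2) := by
        have := hM2
        simp only [one_div] at this
        rwa [Real.sqrt_eq_rpow, Real.sqrt_eq_rpow, Real.sqrt_eq_rpow]
      linarith
  obtain ⟨_, hfin⟩ := hMink (Finset.range r) hPs
  -- split off the principal term and estimate the others
  have hsplit : ∑ α ∈ Finset.range r, Real.sqrt (∑' k, ‖Pc α k‖ ^ 2) =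
      Real.sqrt (∑' k, ‖Pc 0 k‖ ^ 2) + ∑ α ∈ Finset.Ico 1 r, Real.sqrt (∑' k, ‖Pc α k‖ ^ 2) := by
    rw [sum_range_eq_ite_add_sum_Ico, if_pos hr]
  have hrest : ∑ α ∈ Finset.Ico 1 r, Real.sqrt (∑' k, ‖Pc α k‖ ^ 2) ≤
      ∑ α ∈ Finset.Ico 1 r, B α * Real.sqrt (∑' k, ‖md α k‖ ^ 2 * ‖f k‖ ^ 2) :=
    Finset.sum_le_sum fun α hα => hPle α (Finset.mem_range.mpr (Finset.mem_Ico.mp hα).2)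
  rw [hsplit, hP0] at hfin
  linarith [hfin, hrest, hR]

/-! ## Partition, domination, and the max-dominated branch -/

omit [Fintype d] in
/-- **Partition inequality**: if `‖Θ⁺(x)‖² + ‖Θ⁻(x)‖² ≤ 1` pointwise then `∫‖Θ⁺h‖² + ∫‖Θ⁻h‖² ≤ ∫‖h‖²` for continuous `h`
(the two flat-strip families are summed WITHOUT doubling). [folklore] -/
theorem integral_norm_sq_mul_add_le [Fintype d] {Θp Θm h : UnitAddTorus d → ℂ} (hΘp : Continuous Θp)
    (hΘm : Continuous Θm) (hh : Continuous h) (hpart : ∀ x, ‖Θp x‖ ^ 2 + ‖Θm x‖ ^ 2 ≤ 1) :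
    (∫ x, ‖Θp x * h x‖ ^ 2) + ∫ x, ‖Θm x * h x‖ ^ 2 ≤ ∫ x, ‖h x‖ ^ 2 := by
  have hip : Integrable (fun x => ‖Θp x * h x‖ ^ 2) volume := ((hΘp.mul hh).norm.pow 2).integrable_unitAddTorus
  have him : Integrable (fun x => ‖Θm x * h x‖ ^ 2) volume := ((hΘm.mul hh).norm.pow 2).integrable_unitAddTorus
  have hle : ∫ x, (‖Θp x * h x‖ ^ 2 + ‖Θm x * h x‖ ^ 2) ≤ ∫ x, ‖h x‖ ^ 2 := by
    refine integral_mono (hip.add him) ((hh.norm.pow 2).integrable_unitAddTorus) fun x => ?_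
    have hx := hpart x
    have h0 : 0 ≤ ‖h x‖ ^ 2 := sq_nonneg _
    simp only [norm_mul, mul_pow]
    nlinarith
  calc (∫ x, ‖Θp x * h x‖ ^ 2) + ∫ x, ‖Θm x * h x‖ ^ 2 = ∫ x, (‖Θp x * h x‖ ^ 2 + ‖Θm x * h x‖ ^ 2) :=
        (integral_add hip him).symm
    _ ≤ _ := hle

/-- **Domination of symbol energies on the spectrum**: if `m(k)² ≤ μ(k)²` wherever `𝓕F(k) ≠ 0` then
`Σ' m²|𝓕F|² ≤ Σ' μ²|𝓕F|²`. [folklore] -/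
theorem tsum_symbol_sq_le_of_sq_le {F : UnitAddTorus d → ℂ} (hF : Continuous F) {m μ : (d → ℤ) → ℝ} {M : ℝ}
    (hμM : ∀ k, |μ k| ≤ M) (hdom : ∀ k, mFourierCoeff F k ≠ 0 → m k ^ 2 ≤ μ k ^ 2) :
    ∑' k, m k ^ 2 * ‖mFourierCoeff F k‖ ^ 2 ≤ ∑' k, μ k ^ 2 * ‖mFourierCoeff F k‖ ^ 2 := by
  have hle : ∀ k, m k ^ 2 * ‖mFourierCoeff F k‖ ^ 2 ≤ μ k ^ 2 * ‖mFourierCoeff F k‖ ^ 2 := by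
    intro k
    by_cases hk : mFourierCoeff F k = 0
    · simp [hk]
    · exact mul_le_mul_of_nonneg_right (hdom k hk) (sq_nonneg _)
  have hsμ := summable_symbol_sq hF hμM
  exact (hsμ.of_nonneg_of_le (fun k => by positivity) hle).tsum_le_tsum hle hsμ

/-- **The branch energy under domination by the old symbol, principal term kept.**  For `P = e_{q₀}·Ξ·F`, if the
shifted new symbol is dominated on the spectrum of `Ξ·F` (`m(k+q₀)² ≤ μ(k)²`) and `μ` carries expansion data of order
`r ≥ 1` on the spectrum of `Ξ` (`Ξ_0 = Ξ`, `μ_0 = μ`, `‖Ξ_α‖ ≤ B_α`, `‖μ_α‖ ≤ M_α`, remainder `L ρ`), then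
`√Σ' m²|𝓕P|² ≤ √∫‖Ξ · μ(D)F‖² + (Σ_{1≤α<r} B_α M_α + L Σρ|𝓕Ξ|)·‖F‖`
(shift rule, domination, `sqrt_tsum_symbol_sq_mul_le_of_expansion_keep`). [cite: Grafakos2014, Prop. 3.1.2 (5) and Prop. 3.2.7 (3)] -/
theorem sqrt_tsum_symbol_sq_branch_le_max {F Ξ : UnitAddTorus d → ℂ} (hF : Continuous F)
    (hFs : Summable fun k => ‖mFourierCoeff F k‖) (hΞ : Continuous Ξ) (hΞs : Summable fun q => ‖mFourierCoeff Ξ q‖)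
    (q₀ : d → ℤ) (j : d) {r : ℕ} (hr : 0 < r) {Ξd : ℕ → UnitAddTorus d → ℂ}
    (hΞd_c : ∀ α ∈ Finset.range r, Continuous (Ξd α))
    (hΞd_s : ∀ α ∈ Finset.range r, Summable fun q => ‖mFourierCoeff (Ξd α) q‖)
    (hΞd : ∀ α ∈ Finset.range r, ∀ q, mFourierCoeff (Ξd α) q = (2 * Real.pi * I * (q j : ℂ)) ^ α * mFourierCoeff Ξ q)
    (hΞd0 : Ξd 0 = Ξ) {B : ℕ → ℝ} (hB : ∀ α ∈ Finset.range r, ∀ x, ‖Ξd α x‖ ≤ B α)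
    {m μ : (d → ℤ) → ℝ} {Mμ : ℝ} (hμM : ∀ k, |μ k| ≤ Mμ)
    (hdom : ∀ k, mFourierCoeff (fun x => Ξ x * F x) k ≠ 0 → m (k + q₀) ^ 2 ≤ μ k ^ 2)
    {μd : ℕ → (d → ℤ) → ℂ} (hμd0 : ∀ k, μd 0 k = (μ k : ℂ)) {Mα : ℕ → ℝ}
    (hMα : ∀ α ∈ Finset.range r, ∀ k, ‖μd α k‖ ≤ Mα α)
    {ρ : (d → ℤ) → ℝ} {L : ℝ} (hρ0 : ∀ q, 0 ≤ ρ q) (hL : 0 ≤ L)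
    (hT : ∀ k q, mFourierCoeff Ξ q ≠ 0 →
      ‖(μ k : ℂ) - ∑ α ∈ Finset.range r, (2 * Real.pi * I * (q j : ℂ)) ^ α * μd α (k - q)‖ ≤ L * ρ q)
    (hρs : Summable fun q => ρ q * ‖mFourierCoeff Ξ q‖) :
    Real.sqrt (∑' k, m k ^ 2 * ‖mFourierCoeff (fun x => mFourier q₀ x * (Ξ x * F x)) k‖ ^ 2) ≤
      Real.sqrt (∫ x, ‖Ξ x * fourierSynth (fun k => (μ k : ℂ) * mFourierCoeff F k) x‖ ^ 2) +
        (∑ α ∈ Finset.Ico 1 r, B α * Mα α + L * ∑' q, ρ q * ‖mFourierCoeff Ξ q‖) * Real.sqrt (∫ x, ‖F x‖ ^ 2) := by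
  rw [tsum_symbol_sq_mFourier_mul]
  have hΞF : Continuous fun x => Ξ x * F x := hΞ.mul hF
  have hdom' := tsum_symbol_sq_le_of_sq_le hΞF (m := fun k => m (k + q₀)) hμM hdom
  have h1 : Real.sqrt (∑' k, m (k + q₀) ^ 2 * ‖mFourierCoeff (fun x => Ξ x * F x) k‖ ^ 2) ≤
      Real.sqrt (∑' k, μ k ^ 2 * ‖mFourierCoeff (fun x => Ξ x * F x) k‖ ^ 2) := Real.sqrt_le_sqrt hdom'
  have h0mem : 0 ∈ Finset.range r := Finset.mem_range.mpr hr
  have h2 := sqrt_tsum_symbol_sq_mul_le_of_expansion_keep hF hFs hΞ hΞs j hr hΞd_c hΞd_s hΞd hΞd0 hB hμd0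
    (Md := Finset.sup' (Finset.range r) ⟨0, h0mem⟩ Mα) (fun α hα k => (hMα α hα k).trans (Finset.le_sup' Mα hα))
    hρ0 hL hT hρs
  -- the lower-order terms
  have hg0 : 0 ≤ Real.sqrt (∫ x, ‖F x‖ ^ 2) := Real.sqrt_nonneg _
  have hB0 : ∀ α ∈ Finset.range r, 0 ≤ B α := fun α hα => (norm_nonneg _).trans (hB α hα 0)
  have hrest : ∑ α ∈ Finset.Ico 1 r, B α * Real.sqrt (∑' k, ‖μd α k‖ ^ 2 * ‖mFourierCoeff F k‖ ^ 2) ≤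
      (∑ α ∈ Finset.Ico 1 r, B α * Mα α) * Real.sqrt (∫ x, ‖F x‖ ^ 2) := by
    rw [Finset.sum_mul]
    refine Finset.sum_le_sum fun α hα => ?_
    have hα' : α ∈ Finset.range r := Finset.mem_range.mpr (Finset.mem_Ico.mp hα).2
    rw [mul_assoc]
    exact mul_le_mul_of_nonneg_left (sqrt_tsum_norm_sq_mul_le hF fun k => hMα α hα' _) (hB0 α hα')
  have h3 : (∑ α ∈ Finset.Ico 1 r, B α * Mα α) * Real.sqrt (∫ x, ‖F x‖ ^ 2) +
      L * (∑' q, ρ q * ‖mFourierCoeff Ξ q‖) * Real.sqrt (∫ x, ‖F x‖ ^ 2) =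
      (∑ α ∈ Finset.Ico 1 r, B α * Mα α + L * ∑' q, ρ q * ‖mFourierCoeff Ξ q‖) * Real.sqrt (∫ x, ‖F x‖ ^ 2) := by
    ring
  linarith [h1, h2, hrest, h3]

end Summit.AnomalousDissipation.AnomalousDissipation.Theorems.SawtoothPulseCascade.K1Slot
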